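import Literature.MathematicalPhysics.KineticTheory.HardSphereMildBBGKYOneStepWeak
import Literature.Analysis.FluidPDE.HardSphereFlowPerm
import HarnessLib

/-!
# Towards the one-step mild BBGKY hierarchy almost everywhere: untruncated weights
(Cercignani–Illner–Pulvirenti 1994 §4.3, Thm 4.3.1; trunk T-KINETIC, topic
MathematicalPhysics/KineticTheory; continuation of `HardSphereMildBBGKYOneStepWeak`.)

* `regFlow_comp_perm` — the regularised torus flow commutes with relabelling, for all data and
  all times (the good set is permutation invariant, `comp_perm_mem_good_iff`);
* `weak_identity_untruncated` — the weak one-step identity of `weak_identity` for an untruncated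
  symmetric Gaussian-bounded weight (truncation at `M` collision instants and `M → ∞` by dominated
  convergence on both sides).

## References

* C. Cercignani, R. Illner, M. Pulvirenti, *The Mathematical Theory of Dilute Gases*, Springer
  (1994), §4.3.
-/

open MeasureTheory MeasureTheory.Measure Metric Real Set Filter Function Topology
open scoped ENNReal InnerProductSpace
open Literature.Analysis.FluidPDE Literature.Analysis

namespace Literature.MathematicalPhysics.KineticTheory

noncomputable section

section Kinetic

variable {d : Type*} [Fintype d]

section Perm

variable {ε : ℝ} (hε : 0 < ε) (hε' : ε < 2⁻¹) {N : ℕ}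

include hε hε' in
/-- **The regularised torus flow commutes with relabelling**, for every datum and every time:
on the good set by uniqueness of trajectories (`flow_comp_perm_of_nonneg`, the good set being
permutation invariant, and the group law for negative times), off the good set both sides are the
identity. [folklore] -/
theorem regFlow_comp_perm (σ : Equiv.Perm (Fin N)) (t : ℝ) (z : Config N d (UnitAddTorus d)) :
    Alexander.regFlow (Torus.geometry d) ε t (z ∘ σ) = (Alexander.regFlow (Torus.geometry d) ε t z ∘ σ : Config N d (UnitAddTorus d)) := by
  have hG := Torus.isHardSphereRegular_geometry (d := d) hε'
  set Φ := Alexander.regHardSphereFlow (d := d) hε hε' N with hΦ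
  by_cases hz : z ∈ Alexander.good (Torus.geometry d) ε
  · have hzσ : (z ∘ σ : Config N d (UnitAddTorus d)) ∈ Alexander.good (Torus.geometry d) ε :=
      (Alexander.comp_perm_mem_good_iff hG σ z).2 hz
    have hpos : ∀ (s : ℝ), 0 ≤ s → ∀ w : Config N d (UnitAddTorus d), w ∈ Alexander.good (Torus.geometry d) ε →
        Alexander.regFlow (Torus.geometry d) ε s (w ∘ σ) = (Alexander.regFlow (Torus.geometry d) ε s w ∘ σ : Config N d (UnitAddTorus d)) := by
      intro s hs w hw
      have hwσ : (w ∘ σ : Config N d (UnitAddTorus d)) ∈ Alexander.good (Torus.geometry d) ε :=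
        (Alexander.comp_perm_mem_good_iff hG σ w).2 hw
      have h := Φ.flow_comp_perm_of_nonneg σ (z := w) hw hwσ hs
      simpa [hΦ] using h
    rcases le_or_gt 0 t with ht | ht
    · exact hpos t ht z hz
    · -- negative time: apply `Φ_{-t}` to `Φ_{-t} (w ∘ σ) = z ∘ σ`, `w = Φ_t z`
      set w := Alexander.regFlow (Torus.geometry d) ε t z with hw
      have hwg : w ∈ Alexander.good (Torus.geometry d) ε := by
        have := Φ.mapsTo_good t hz
        simpa [hΦ] using this
      have h := hpos (-t) (by linarith) w hwg
      have hwz : Alexander.regFlow (Torus.geometry d) ε (-t) w = z := by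
        rw [hw, ← Alexander.regFlow_add hε hε', neg_add_cancel, Alexander.regFlow_zero hε hε']
      rw [hwz] at h
      have := congrArg (Alexander.regFlow (Torus.geometry d) ε t) h
      rw [← Alexander.regFlow_add hε hε', add_neg_cancel, Alexander.regFlow_zero hε hε'] at this
      exact this.symm
  · have hzσ : (z ∘ σ : Config N d (UnitAddTorus d)) ∉ Alexander.good (Torus.geometry d) ε :=
      fun h => hz ((Alexander.comp_perm_mem_good_iff hG σ z).1 h)
    rw [Alexander.regFlow_of_not_mem hz, Alexander.regFlow_of_not_mem hzσ]

end Perm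

section Untruncated

variable {ε : ℝ} (hε : 0 < ε) (hε' : ε < 2⁻¹)

set_option maxHeartbeats 4000000 in
include hε hε' in
/-- **The weak one-step identity for untruncated weights** (CIP 1994 Thm 4.3.1 in weak form).
For a measurable set `B` of good tagged configurations and a measurable weight `W` on
`Config (k + (m'+1))` with a Gaussian bound, symmetric under the transpositions of the untagged
labels with the last one, the increment over `(0, t]` of `∫_{good} 1_{Φ^k_s B}(π Φ_s z₀) W(z₀) dz₀`
equals `m = m'+1` times the sum over the tagged labels `i` of the clean flux integrals
`∫ ε^{d-1}(⟪v - v_i, ν⟫)₊ 1_{good}(w) (1_{Φ^k_{τ'}B}(π w) - 1_{Φ^k_{τ'}B}(π w')) W(Φ_{-τ'} w)`,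
`w = lossConfig Z' i ν v`, `w' = collidePair I L w`, `τ' ∈ (0, t]` (`weak_identity` for the
truncations `1_{good} 1_{n(·,t) ≤ M} W`, symmetric by `comp_perm_mem_good_iff` /
`collisionCount_comp_perm`, and `M → ∞` by dominated convergence on both sides).
[cite: CIP1994, Thm 4.3.1] -/
theorem weak_identity_untruncated [Nonempty d] [DecidableEq d] {k m' : ℕ} [NeZero k] {t : ℝ} (ht : 0 < t)
    {B : Set (Config k d (UnitAddTorus d))} (hB : MeasurableSet B) (hBg : B ⊆ Alexander.good (Torus.geometry d) ε)
    {W : Config (k + (m' + 1)) d (UnitAddTorus d) → ℝ} (hW : Measurable W)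
    (hWσ : ∀ (J : Fin (m' + 1)) (z : Config (k + (m' + 1)) d (UnitAddTorus d)),
      W (z ∘ Equiv.swap (Fin.natAdd k J) (Fin.natAdd k (Fin.last m')) : Config (k + (m' + 1)) d (UnitAddTorus d)) = W z)
    {CW β : ℝ} (hCW : 0 ≤ CW) (hβ : 0 < β) (hWb : ∀ z, |W z| ≤ CW * Real.exp (-β * configEnergy z)) :
    (∫ z₀ in Alexander.good (Torus.geometry d) ε,
          (Alexander.regFlow (Torus.geometry d) ε (t) '' B).indicator (1 : Config k d (UnitAddTorus d) → ℝ) (Alexander.regFlow (Torus.geometry d) ε (t) z₀ ∘ Fin.castAdd (m' + 1)) * W z₀) -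
        ∫ z₀ in Alexander.good (Torus.geometry d) ε, (Alexander.regFlow (Torus.geometry d) ε (0) '' B).indicator (1 : Config k d (UnitAddTorus d) → ℝ) (z₀ ∘ Fin.castAdd (m' + 1)) * W z₀ =
      (m' + 1 : ℝ) * ∑ i : Fin k, ∫ p, ε ^ (Fintype.card d - 1) * max ⟪p.1.2 - (p.1.1 (Fin.castAdd m' i)).2, (p.2.1 : EuclideanSpace ℝ d)⟫_ℝ 0 *
          (Alexander.good (Torus.geometry d) ε).indicator (fun w =>
            ((Alexander.regFlow (Torus.geometry d) ε (p.2.2) '' B).indicator (1 : Config k d (UnitAddTorus d) → ℝ) (w ∘ Fin.castAdd (m' + 1)) -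
              (Alexander.regFlow (Torus.geometry d) ε (p.2.2) '' B).indicator (1 : Config k d (UnitAddTorus d) → ℝ) (collidePair (Torus.geometry d) (Fin.castAdd (m' + 1) i) (Fin.natAdd k (Fin.last m')) w ∘ Fin.castAdd (m' + 1))) *
            W (Alexander.regFlow (Torus.geometry d) ε (-p.2.2) w)) (lossConfig (Torus.geometry d) ε p.1.1 (Fin.castAdd m' i) p.2.1 p.1.2)
        ∂((((volume : Measure (Config (k + m') d (UnitAddTorus d))).prod (volume : Measure (EuclideanSpace ℝ d))).prod ((((volume : Measure (EuclideanSpace ℝ d)).toSphere).prod ((volume : Measure ℝ).restrict (Ioc 0 t)))))) := by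
  classical
  haveI hXE : SigmaFinite (volume : Measure (UnitAddTorus d × EuclideanSpace ℝ d)) := inferInstance
  haveI hC : SigmaFinite (volume : Measure (Config (k + m') d (UnitAddTorus d))) := inferInstance
  haveI hσf : IsFiniteMeasure ((volume : Measure (EuclideanSpace ℝ d)).toSphere) := inferInstance
  haveI : NeZero (k + m') := ⟨by have := NeZero.ne k; omega⟩
  have hG := Torus.isHardSphereRegular_geometry (d := d) hε'
  have hGm := Torus.isMeasurable_geometry (d := d)
  have hgoodm := Alexander.measurableSet_good (N := k + (m' + 1)) hG hGm
  have hWi : Integrable W :=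
    Integrable.mono' ((integrable_exp_neg_mul_configEnergy hβ).const_mul CW) hW.aestronglyMeasurable
      (Filter.Eventually.of_forall fun z => by rw [Real.norm_eq_abs]; exact hWb z)
  -- the truncated weights
  set WM : ℕ → Config (k + (m' + 1)) d (UnitAddTorus d) → ℝ := fun M z => (Alexander.good (Torus.geometry d) ε).indicator
    (fun z => {z : Config (k + (m' + 1)) d (UnitAddTorus d) | Alexander.collisionCount (Torus.geometry d) ε z t ≤ M}.indicator (1 : Config (k + (m' + 1)) d (UnitAddTorus d) → ℝ) z * W z) z with hWM
  have hCm : ∀ M : ℕ, MeasurableSet {z : Config (k + (m' + 1)) d (UnitAddTorus d) | Alexander.collisionCount (Torus.geometry d) ε z t ≤ M} := fun M => by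
    have : {z : Config (k + (m' + 1)) d (UnitAddTorus d) | Alexander.collisionCount (Torus.geometry d) ε z t ≤ M} =
        (fun z : Config (k + (m' + 1)) d (UnitAddTorus d) => Alexander.collisionCount (Torus.geometry d) ε z t) ⁻¹' {n : ℕ | n ≤ M} := rfl
    rw [this]
    exact (Set.to_countable _).measurableSet.preimage (Alexander.measurable_collisionCount hG hGm t)
  have hWMm : ∀ M, Measurable (WM M) := fun M => by
    simp only [hWM]; exact ((measurable_const.indicator (hCm M)).mul hW).indicator hgoodm
  have hind01 : ∀ (S : Set (Config (k + (m' + 1)) d (UnitAddTorus d))) (y : Config (k + (m' + 1)) d (UnitAddTorus d)), 0 ≤ S.indicator (1 : Config (k + (m' + 1)) d (UnitAddTorus d) → ℝ) y ∧ S.indicator (1 : Config (k + (m' + 1)) d (UnitAddTorus d) → ℝ) y ≤ 1 := by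
    intro S y
    by_cases h : y ∈ S
    · rw [indicator_of_mem h, Pi.one_apply]; exact ⟨zero_le_one, le_rfl⟩
    · rw [indicator_of_notMem h]; exact ⟨le_rfl, zero_le_one⟩
  have hWM_le : ∀ M z, |WM M z| ≤ |W z| := by
    intro M z
    simp only [hWM]
    by_cases hz : z ∈ Alexander.good (Torus.geometry d) ε
    · rw [indicator_of_mem hz, abs_mul, abs_of_nonneg (hind01 _ z).1]
      exact mul_le_of_le_one_left (abs_nonneg _) (hind01 _ z).2
    · rw [indicator_of_notMem hz, abs_zero]; exact abs_nonneg _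
  have hWMb : ∀ M z, |WM M z| ≤ CW * Real.exp (-β * configEnergy z) := fun M z => (hWM_le M z).trans (hWb z)
  have hWMσ : ∀ (M : ℕ) (J : Fin (m' + 1)) (z : Config (k + (m' + 1)) d (UnitAddTorus d)),
      WM M (z ∘ Equiv.swap (Fin.natAdd k J) (Fin.natAdd k (Fin.last m')) : Config (k + (m' + 1)) d (UnitAddTorus d)) = WM M z := by
    intro M J z
    simp only [hWM]
    by_cases hz : z ∈ Alexander.good (Torus.geometry d) ε
    · have hzσ : (z ∘ Equiv.swap (Fin.natAdd k J) (Fin.natAdd k (Fin.last m')) : Config (k + (m' + 1)) d (UnitAddTorus d)) ∈ Alexander.good (Torus.geometry d) ε :=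
        (Alexander.comp_perm_mem_good_iff hG _ z).2 hz
      rw [indicator_of_mem hzσ, indicator_of_mem hz, hWσ J z]
      have hcount : Alexander.collisionCount (Torus.geometry d) ε (z ∘ Equiv.swap (Fin.natAdd k J) (Fin.natAdd k (Fin.last m')) : Config (k + (m' + 1)) d (UnitAddTorus d)) t =
          Alexander.collisionCount (Torus.geometry d) ε z t := Alexander.collisionCount_comp_perm hG hz.2.2.1 _ t
      have hset : ((z ∘ Equiv.swap (Fin.natAdd k J) (Fin.natAdd k (Fin.last m')) : Config (k + (m' + 1)) d (UnitAddTorus d)) ∈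
          {z : Config (k + (m' + 1)) d (UnitAddTorus d) | Alexander.collisionCount (Torus.geometry d) ε z t ≤ M}) ↔
          z ∈ {z : Config (k + (m' + 1)) d (UnitAddTorus d) | Alexander.collisionCount (Torus.geometry d) ε z t ≤ M} := by
        simp only [mem_setOf_eq, hcount]
      by_cases hc : z ∈ {z : Config (k + (m' + 1)) d (UnitAddTorus d) | Alexander.collisionCount (Torus.geometry d) ε z t ≤ M}
      · rw [indicator_of_mem hc, indicator_of_mem (hset.2 hc)]; simp only [Pi.one_apply]
      · rw [indicator_of_notMem hc, indicator_of_notMem (fun h => hc (hset.1 h))]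
    · have hzσ : (z ∘ Equiv.swap (Fin.natAdd k J) (Fin.natAdd k (Fin.last m')) : Config (k + (m' + 1)) d (UnitAddTorus d)) ∉ Alexander.good (Torus.geometry d) ε :=
        fun h => hz ((Alexander.comp_perm_mem_good_iff hG _ z).1 h)
      rw [indicator_of_notMem hzσ, indicator_of_notMem hz]
  have hWMtr : ∀ (M : ℕ) z, M < Alexander.collisionCount (Torus.geometry d) ε z t → WM M z = 0 := by
    intro M z hz
    simp only [hWM]
    by_cases hzg : z ∈ Alexander.good (Torus.geometry d) ε
    · rw [indicator_of_mem hzg, indicator_of_notMem, zero_mul]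
      simp only [mem_setOf_eq, not_le]; exact hz
    · rw [indicator_of_notMem hzg]
  -- pointwise convergence of the truncated weights on the good set
  have hWMlim : ∀ z ∈ Alexander.good (Torus.geometry d) ε, ∀ᶠ M : ℕ in atTop, WM M z = W z := by
    intro z hz
    filter_upwards [Filter.eventually_ge_atTop (Alexander.collisionCount (Torus.geometry d) ε z t)] with M hM
    simp only [hWM]
    rw [indicator_of_mem hz, indicator_of_mem (show z ∈ {z : Config (k + (m' + 1)) d (UnitAddTorus d) | Alexander.collisionCount (Torus.geometry d) ε z t ≤ M} from hM),
      Pi.one_apply, one_mul]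
  -- the truncated identities
  have hM : ∀ M : ℕ, (∫ z₀ in Alexander.good (Torus.geometry d) ε,
          (Alexander.regFlow (Torus.geometry d) ε (t) '' B).indicator (1 : Config k d (UnitAddTorus d) → ℝ) (Alexander.regFlow (Torus.geometry d) ε (t) z₀ ∘ Fin.castAdd (m' + 1)) * WM M z₀) -
        ∫ z₀ in Alexander.good (Torus.geometry d) ε, (Alexander.regFlow (Torus.geometry d) ε (0) '' B).indicator (1 : Config k d (UnitAddTorus d) → ℝ) (z₀ ∘ Fin.castAdd (m' + 1)) * WM M z₀ =
      (m' + 1 : ℝ) * ∑ i : Fin k, ∫ p, ε ^ (Fintype.card d - 1) * max ⟪p.1.2 - (p.1.1 (Fin.castAdd m' i)).2, (p.2.1 : EuclideanSpace ℝ d)⟫_ℝ 0 *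
          (Alexander.good (Torus.geometry d) ε).indicator (fun w =>
            ((Alexander.regFlow (Torus.geometry d) ε (p.2.2) '' B).indicator (1 : Config k d (UnitAddTorus d) → ℝ) (w ∘ Fin.castAdd (m' + 1)) -
              (Alexander.regFlow (Torus.geometry d) ε (p.2.2) '' B).indicator (1 : Config k d (UnitAddTorus d) → ℝ) (collidePair (Torus.geometry d) (Fin.castAdd (m' + 1) i) (Fin.natAdd k (Fin.last m')) w ∘ Fin.castAdd (m' + 1))) *
            WM M (Alexander.regFlow (Torus.geometry d) ε (-p.2.2) w)) (lossConfig (Torus.geometry d) ε p.1.1 (Fin.castAdd m' i) p.2.1 p.1.2)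
        ∂((((volume : Measure (Config (k + m') d (UnitAddTorus d))).prod (volume : Measure (EuclideanSpace ℝ d))).prod ((((volume : Measure (EuclideanSpace ℝ d)).toSphere).prod ((volume : Measure ℝ).restrict (Ioc 0 t)))))) := fun M =>
    weak_identity hε hε' ht hB hBg (hWMm M) (hWMσ M) hCW hβ (hWMb M) (hWMtr M)
  -- the left-hand sides converge
  have hπ : Measurable fun w : Config (k + (m' + 1)) d (UnitAddTorus d) => (w ∘ Fin.castAdd (m' + 1) : Config k d (UnitAddTorus d)) :=
    measurable_pi_lambda _ fun j => measurable_pi_apply _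
  have hψm : ∀ s : ℝ, Measurable fun z₀ : Config (k + (m' + 1)) d (UnitAddTorus d) => (Alexander.regFlow (Torus.geometry d) ε s '' B).indicator (1 : Config k d (UnitAddTorus d) → ℝ)
      (Alexander.regFlow (Torus.geometry d) ε s z₀ ∘ Fin.castAdd (m' + 1)) := by
    intro s
    have himg : MeasurableSet (Alexander.regFlow (Torus.geometry d) ε s '' B) :=
      (Alexander.regHardSphereFlow hε hε' k).measurableSet_image_flow s hB hBg
    exact (measurable_const.indicator himg).comp (hπ.comp (Alexander.measurable_regFlow hε' s))
  have hψ0m : Measurable fun z₀ : Config (k + (m' + 1)) d (UnitAddTorus d) => (Alexander.regFlow (Torus.geometry d) ε 0 '' B).indicator (1 : Config k d (UnitAddTorus d) → ℝ) (z₀ ∘ Fin.castAdd (m' + 1)) := by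
    have himg : MeasurableSet (Alexander.regFlow (Torus.geometry d) ε 0 '' B) :=
      (Alexander.regHardSphereFlow hε hε' k).measurableSet_image_flow 0 hB hBg
    exact (measurable_const.indicator himg).comp hπ
  have hind01k : ∀ (S : Set (Config k d (UnitAddTorus d))) (y : Config k d (UnitAddTorus d)), 0 ≤ S.indicator (1 : Config k d (UnitAddTorus d) → ℝ) y ∧ S.indicator (1 : Config k d (UnitAddTorus d) → ℝ) y ≤ 1 := by
    intro S y
    by_cases h : y ∈ S
    · rw [indicator_of_mem h, Pi.one_apply]; exact ⟨zero_le_one, le_rfl⟩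
    · rw [indicator_of_notMem h]; exact ⟨le_rfl, zero_le_one⟩
  have hLlim : ∀ (g : Config (k + (m' + 1)) d (UnitAddTorus d) → ℝ), Measurable g → (∀ z, |g z| ≤ 1) →
      Tendsto (fun M : ℕ => ∫ z₀ in Alexander.good (Torus.geometry d) ε, g z₀ * WM M z₀) atTop
        (𝓝 (∫ z₀ in Alexander.good (Torus.geometry d) ε, g z₀ * W z₀)) := by
    intro g hg hg1
    refine tendsto_integral_of_dominated_convergence (fun z₀ => |W z₀|) (fun M => (hg.mul (hWMm M)).aestronglyMeasurable)
      hWi.abs.integrableOn (fun M => ae_of_all _ fun z₀ => ?_) ?_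
    · rw [Real.norm_eq_abs, abs_mul]
      calc _ ≤ 1 * |W z₀| := mul_le_mul (hg1 z₀) (hWM_le M z₀) (abs_nonneg _) zero_le_one
        _ = |W z₀| := one_mul _
    · rw [ae_restrict_iff' hgoodm]
      refine ae_of_all _ fun z₀ hz₀ => ?_
      exact tendsto_const_nhds.congr' ((hWMlim z₀ hz₀).mono fun M hM => by beta_reduce; rw [hM])
  have hg1 : ∀ (S : Set (Config k d (UnitAddTorus d))) (y : Config k d (UnitAddTorus d)), |S.indicator (1 : Config k d (UnitAddTorus d) → ℝ) y| ≤ 1 := fun S y => by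
    rw [abs_of_nonneg (hind01k S y).1]; exact (hind01k S y).2
  -- the right-hand sides converge
  have hZ : Measurable fun p : (Config (k + m') d (UnitAddTorus d) × EuclideanSpace ℝ d) × (sphere (0 : EuclideanSpace ℝ d) 1 × ℝ) => p.1.1 := measurable_fst.fst
  have hv : Measurable fun p : (Config (k + m') d (UnitAddTorus d) × EuclideanSpace ℝ d) × (sphere (0 : EuclideanSpace ℝ d) 1 × ℝ) => p.1.2 := measurable_fst.snd
  have hν : Measurable fun p : (Config (k + m') d (UnitAddTorus d) × EuclideanSpace ℝ d) × (sphere (0 : EuclideanSpace ℝ d) 1 × ℝ) => (p.2.1 : EuclideanSpace ℝ d) := continuous_subtype_val.measurable.comp measurable_snd.fst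
  have hτ : Measurable fun p : (Config (k + m') d (UnitAddTorus d) × EuclideanSpace ℝ d) × (sphere (0 : EuclideanSpace ℝ d) 1 × ℝ) => p.2.2 := measurable_snd.snd
  have hRlim : ∀ i : Fin k, Tendsto (fun M : ℕ => ∫ p, ε ^ (Fintype.card d - 1) * max ⟪p.1.2 - (p.1.1 (Fin.castAdd m' i)).2, (p.2.1 : EuclideanSpace ℝ d)⟫_ℝ 0 *
          (Alexander.good (Torus.geometry d) ε).indicator (fun w =>
            ((Alexander.regFlow (Torus.geometry d) ε (p.2.2) '' B).indicator (1 : Config k d (UnitAddTorus d) → ℝ) (w ∘ Fin.castAdd (m' + 1)) -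
              (Alexander.regFlow (Torus.geometry d) ε (p.2.2) '' B).indicator (1 : Config k d (UnitAddTorus d) → ℝ) (collidePair (Torus.geometry d) (Fin.castAdd (m' + 1) i) (Fin.natAdd k (Fin.last m')) w ∘ Fin.castAdd (m' + 1))) *
            WM M (Alexander.regFlow (Torus.geometry d) ε (-p.2.2) w)) (lossConfig (Torus.geometry d) ε p.1.1 (Fin.castAdd m' i) p.2.1 p.1.2) ∂((((volume : Measure (Config (k + m') d (UnitAddTorus d))).prod (volume : Measure (EuclideanSpace ℝ d))).prod ((((volume : Measure (EuclideanSpace ℝ d)).toSphere).prod ((volume : Measure ℝ).restrict (Ioc 0 t))))))) atTop (𝓝 (∫ p, ε ^ (Fintype.card d - 1) * max ⟪p.1.2 - (p.1.1 (Fin.castAdd m' i)).2, (p.2.1 : EuclideanSpace ℝ d)⟫_ℝ 0 *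
          (Alexander.good (Torus.geometry d) ε).indicator (fun w =>
            ((Alexander.regFlow (Torus.geometry d) ε (p.2.2) '' B).indicator (1 : Config k d (UnitAddTorus d) → ℝ) (w ∘ Fin.castAdd (m' + 1)) -
              (Alexander.regFlow (Torus.geometry d) ε (p.2.2) '' B).indicator (1 : Config k d (UnitAddTorus d) → ℝ) (collidePair (Torus.geometry d) (Fin.castAdd (m' + 1) i) (Fin.natAdd k (Fin.last m')) w ∘ Fin.castAdd (m' + 1))) *
            W (Alexander.regFlow (Torus.geometry d) ε (-p.2.2) w)) (lossConfig (Torus.geometry d) ε p.1.1 (Fin.castAdd m' i) p.2.1 p.1.2) ∂((((volume : Measure (Config (k + m') d (UnitAddTorus d))).prod (volume : Measure (EuclideanSpace ℝ d))).prod ((((volume : Measure (EuclideanSpace ℝ d)).toSphere).prod ((volume : Measure ℝ).restrict (Ioc 0 t)))))))) := by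
    intro i
    set I : Fin (k + (m' + 1)) := Fin.castAdd (m' + 1) i with hI
    set L : Fin (k + (m' + 1)) := Fin.natAdd k (Fin.last m') with hL
    set i' : Fin (k + m') := Fin.castAdd m' i with hi'
    set bodyW : (Config (k + (m' + 1)) d (UnitAddTorus d) → ℝ) → ℝ → Config (k + (m' + 1)) d (UnitAddTorus d) → ℝ := fun U τ w =>
      ((Alexander.regFlow (Torus.geometry d) ε τ '' B).indicator (1 : Config k d (UnitAddTorus d) → ℝ) (w ∘ Fin.castAdd (m' + 1)) -
        (Alexander.regFlow (Torus.geometry d) ε τ '' B).indicator (1 : Config k d (UnitAddTorus d) → ℝ) (collidePair (Torus.geometry d) I L w ∘ Fin.castAdd (m' + 1))) *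
      U (Alexander.regFlow (Torus.geometry d) ε (-τ) w) with hbodyW
    set loss : (Config (k + m') d (UnitAddTorus d) × EuclideanSpace ℝ d) × (sphere (0 : EuclideanSpace ℝ d) 1 × ℝ) → Config (k + (m' + 1)) d (UnitAddTorus d) := fun p => (lossConfig (Torus.geometry d) ε p.1.1 (Fin.castAdd m' i) p.2.1 p.1.2) with hloss
    set flux : (Config (k + m') d (UnitAddTorus d) × EuclideanSpace ℝ d) × (sphere (0 : EuclideanSpace ℝ d) 1 × ℝ) → ℝ := fun p => ε ^ (Fintype.card d - 1) * max ⟪p.1.2 - (p.1.1 i').2, (p.2.1 : EuclideanSpace ℝ d)⟫_ℝ 0 with hflux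
    set GM : ℕ → (Config (k + m') d (UnitAddTorus d) × EuclideanSpace ℝ d) × (sphere (0 : EuclideanSpace ℝ d) 1 × ℝ) → ℝ := fun M p => flux p * (Alexander.good (Torus.geometry d) ε).indicator (bodyW (WM M) p.2.2) (loss p) with hGM
    set G0 : (Config (k + m') d (UnitAddTorus d) × EuclideanSpace ℝ d) × (sphere (0 : EuclideanSpace ℝ d) 1 × ℝ) → ℝ := fun p => flux p * (Alexander.good (Torus.geometry d) ε).indicator (bodyW W p.2.2) (loss p) with hG0
    show Tendsto (fun M : ℕ => ∫ p, GM M p ∂((((volume : Measure (Config (k + m') d (UnitAddTorus d))).prod (volume : Measure (EuclideanSpace ℝ d))).prod ((((volume : Measure (EuclideanSpace ℝ d)).toSphere).prod ((volume : Measure ℝ).restrict (Ioc 0 t))))))) atTop (𝓝 (∫ p, G0 p ∂((((volume : Measure (Config (k + m') d (UnitAddTorus d))).prod (volume : Measure (EuclideanSpace ℝ d))).prod ((((volume : Measure (EuclideanSpace ℝ d)).toSphere).prod ((volume : Measure ℝ).restrict (Ioc 0 t))))))))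
    have hbr_le : ∀ (τ : ℝ) (w : Config (k + (m' + 1)) d (UnitAddTorus d)), |(Alexander.regFlow (Torus.geometry d) ε τ '' B).indicator (1 : Config k d (UnitAddTorus d) → ℝ) (w ∘ Fin.castAdd (m' + 1)) -
        (Alexander.regFlow (Torus.geometry d) ε τ '' B).indicator (1 : Config k d (UnitAddTorus d) → ℝ) (collidePair (Torus.geometry d) I L w ∘ Fin.castAdd (m' + 1))| ≤ 1 := by
      intro τ w
      have h1 := hind01k (Alexander.regFlow (Torus.geometry d) ε τ '' B) (w ∘ Fin.castAdd (m' + 1))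
      have h2 := hind01k (Alexander.regFlow (Torus.geometry d) ε τ '' B) (collidePair (Torus.geometry d) I L w ∘ Fin.castAdd (m' + 1))
      rw [abs_le]; constructor <;> linarith [h1.1, h1.2, h2.1, h2.2]
    have hgb_le : ∀ (U : Config (k + (m' + 1)) d (UnitAddTorus d) → ℝ), (∀ z, |U z| ≤ CW * Real.exp (-β * configEnergy z)) → ∀ p,
        |(Alexander.good (Torus.geometry d) ε).indicator (bodyW U p.2.2) (loss p)| ≤ CW * Real.exp (-β * configEnergy (loss p)) := by
      intro U hU p
      by_cases hg : loss p ∈ Alexander.good (Torus.geometry d) ε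
      · rw [indicator_of_mem hg]
        simp only [hbodyW]
        rw [abs_mul]
        have hWw := hU (Alexander.regFlow (Torus.geometry d) ε (-p.2.2) (loss p))
        rw [Alexander.configEnergy_regFlow] at hWw
        calc _ ≤ 1 * (CW * Real.exp (-β * configEnergy (loss p))) := mul_le_mul (hbr_le _ _) hWw (abs_nonneg _) zero_le_one
          _ = _ := one_mul _
      · rw [indicator_of_notMem hg, abs_zero]; positivity
    have hflux_le : ∀ p : (Config (k + m') d (UnitAddTorus d) × EuclideanSpace ℝ d) × (sphere (0 : EuclideanSpace ℝ d) 1 × ℝ), |flux p| ≤ ε ^ (Fintype.card d - 1) * ((1 + ‖(p.1.1 i').2‖) * (1 + ‖p.1.2‖)) := by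
      intro p
      simp only [hflux]
      have hεp : 0 ≤ ε ^ (Fintype.card d - 1) := pow_nonneg hε.le _
      rw [abs_of_nonneg (mul_nonneg hεp (le_max_right _ _))]
      refine mul_le_mul_of_nonneg_left ?_ hεp
      refine max_le ?_ (by positivity)
      calc ⟪p.1.2 - (p.1.1 i').2, (p.2.1 : EuclideanSpace ℝ d)⟫_ℝ ≤ ‖p.1.2 - (p.1.1 i').2‖ * ‖(p.2.1 : EuclideanSpace ℝ d)‖ := real_inner_le_norm _ _
        _ = ‖p.1.2 - (p.1.1 i').2‖ := by rw [norm_eq_of_mem_sphere p.2.1, mul_one]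
        _ ≤ ‖p.1.2‖ + ‖(p.1.1 i').2‖ := norm_sub_le _ _
        _ ≤ (1 + ‖(p.1.1 i').2‖) * (1 + ‖p.1.2‖) := by nlinarith [norm_nonneg p.1.2, norm_nonneg (p.1.1 i').2]
    set Dom : (Config (k + m') d (UnitAddTorus d) × EuclideanSpace ℝ d) × (sphere (0 : EuclideanSpace ℝ d) 1 × ℝ) → ℝ := fun p => ε ^ (Fintype.card d - 1) * CW * (((1 + ‖(p.1.1 i').2‖) * Real.exp (-β * configEnergy p.1.1)) *
      ((1 + ‖p.1.2‖) * Real.exp (-(β / 2) * ‖p.1.2‖ ^ 2))) with hDom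
    have hDomi : Integrable Dom ((((volume : Measure (Config (k + m') d (UnitAddTorus d))).prod (volume : Measure (EuclideanSpace ℝ d))).prod ((((volume : Measure (EuclideanSpace ℝ d)).toSphere).prod ((volume : Measure ℝ).restrict (Ioc 0 t)))))) :=
      (integrable_fluxDominator (d := d) (k := k) (m' := m') i' hβ t).const_mul (ε ^ (Fintype.card d - 1) * CW)
    have hGM_le : ∀ M p, |GM M p| ≤ Dom p := by
      intro M p
      simp only [hGM, hDom]
      rw [abs_mul]
      have h1 := hflux_le p
      have h2 := hgb_le (WM M) (hWMb M) p
      have hexp : Real.exp (-β * configEnergy (loss p)) = Real.exp (-β * configEnergy p.1.1) * Real.exp (-(β / 2) * ‖p.1.2‖ ^ 2) := by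
        simp only [hloss]
        rw [configEnergy_lossConfig, ← Real.exp_add]; congr 1; ring
      rw [hexp] at h2
      calc |flux p| * |(Alexander.good (Torus.geometry d) ε).indicator (bodyW (WM M) p.2.2) (loss p)| ≤
          (ε ^ (Fintype.card d - 1) * ((1 + ‖(p.1.1 i').2‖) * (1 + ‖p.1.2‖))) *
            (CW * (Real.exp (-β * configEnergy p.1.1) * Real.exp (-(β / 2) * ‖p.1.2‖ ^ 2))) :=
            mul_le_mul h1 h2 (abs_nonneg _) (by positivity)
        _ = _ := by ring
    -- measurability
    have hvi : Measurable fun p : (Config (k + m') d (UnitAddTorus d) × EuclideanSpace ℝ d) × (sphere (0 : EuclideanSpace ℝ d) 1 × ℝ) => (p.1.1 i').2 := ((measurable_pi_apply i').comp hZ).snd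
    have hfluxm : Measurable flux := by
      simp only [hflux]; exact measurable_const.mul (((hv.sub hvi).inner hν).max measurable_const)
    have hlossm : Measurable loss := by simp only [hloss]; exact measurable_lossConfig hGm.measurable_translate ε i' hZ hν hv
    have hbodym : ∀ (U : Config (k + (m' + 1)) d (UnitAddTorus d) → ℝ), Measurable U → Measurable fun q : ℝ × Config (k + (m' + 1)) d (UnitAddTorus d) => (Alexander.good (Torus.geometry d) ε).indicator (bodyW U q.1) q.2 := by
      intro U hU
      have h := measurable_eventIntegrand hε hε' I L 0 hB hU hgoodm
      simp only [zero_add] at h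
      simpa only [hbodyW] using h
    have hGMm : ∀ M, Measurable (GM M) := by
      intro M
      have h := (hbodym (WM M) (hWMm M)).comp (hτ.prodMk hlossm)
      have h2 := hfluxm.mul h
      simp only [hGM]; exact h2
    -- pointwise: eventually equal
    have hlim : ∀ᵐ p ∂((((volume : Measure (Config (k + m') d (UnitAddTorus d))).prod (volume : Measure (EuclideanSpace ℝ d))).prod ((((volume : Measure (EuclideanSpace ℝ d)).toSphere).prod ((volume : Measure ℝ).restrict (Ioc 0 t)))))), Tendsto (fun M => GM M p) atTop (𝓝 (G0 p)) := by
      refine ae_of_all _ fun p => ?_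
      by_cases hg : loss p ∈ Alexander.good (Torus.geometry d) ε
      · have hwg : Alexander.regFlow (Torus.geometry d) ε (-p.2.2) (loss p) ∈ Alexander.good (Torus.geometry d) ε := by
          have := (Alexander.regHardSphereFlow hε hε' (k + (m' + 1))).mapsTo_good (-p.2.2) hg
          simpa using this
        have hEq : ∀ᶠ M : ℕ in atTop, GM M p = G0 p := by
          filter_upwards [hWMlim _ hwg] with M hM
          simp only [hGM, hG0]
          rw [indicator_of_mem hg, indicator_of_mem hg]
          simp only [hbodyW]
          rw [hM]
        exact tendsto_const_nhds.congr' (hEq.mono fun M hM => hM.symm)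
      · have hEq : ∀ M, GM M p = G0 p := fun M => by
          simp only [hGM, hG0]; rw [indicator_of_notMem hg, indicator_of_notMem hg]
        simp only [hEq]; exact tendsto_const_nhds
    exact tendsto_integral_of_dominated_convergence Dom (fun M => (hGMm M).aestronglyMeasurable) hDomi
      (fun M => ae_of_all _ fun p => by rw [Real.norm_eq_abs]; exact hGM_le M p) hlim
  -- pass to the limit in the truncated identities
  have hlimL := (hLlim _ (hψm t) (fun z => hg1 _ _)).sub (hLlim _ hψ0m (fun z => hg1 _ _))
  have hlimR := Tendsto.const_mul (m' + 1 : ℝ) (tendsto_finsetSum (Finset.univ : Finset (Fin k)) fun i _ => hRlim i)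
  exact tendsto_nhds_unique (hlimL.congr fun M => hM M) hlimR

end Untruncated

end Kinetic

end

end Literature.MathematicalPhysics.KineticTheory
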